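import Summits.QuantumFields.YangMills.Theorems.UnitScaleTiltProp7GramInverseFarTailMember
import HarnessLib

/-!
# Route `UnitScaleTilt`, crux K1 «MinimiserStabilityRegPr» (stmt-QuantumFields-19200), EX row `hGF[Lift]` (curved member) — **LOD LINE, PEN (L5″) (RN-far) FILE D (MEMBER DISCHARGE):
# THE FAR TAIL OF THE GRAM-INVERSE COORDINATES AT `RegPr`, TWO BACKGROUNDS** — ✓`Prop7GramInverseFarTailMember.sqrt_sum_normSq_far_gramInv_coords_le` (p757450) with its two
# displayed rows DISCHARGED BY NAME: `hN` (decay of the coarse Gram inverse of the COMPARISON system `(G_1, T_1)` at a second `RegPr` background `V₀` — e.g. `V₀ = 1` via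
# ✓`T3PrintedRegularMinimiser.regPr_one` — ⟸ ✓`Prop7CoarseGramInverseDecay.norm_gram_inv_spike_le_exp_neg_tdist`, B2c p753397, at slope `μ′`) and `hcol` (localisation of the
# `W`-system spike columns `G(T(b_c i))` at the background `U₀` ⟸ ✓`Prop7ComplementaryProjectorBlockDecay.norm_inner_spike_column_le`, B4 §2 p753767, at slope `μ`); both systems
# share the lattice data `F, n ≤ K, c₀, c₁, ε₀, a`, the lift `ι` and px17's coarse spike basis `b_c`.  What stays displayed is exactly what B2c ∕ B4 display: the window rows
# `hδ hwin` (slope `μ`, system `U₀`), `hδV hwinV` + gap `hgapV` + `hCTbV hGnV hmBV hcoerV` (slope `μ′`, system `V₀`; `hcoerV` = (L4′) ✓`Prop7CoarseGramCoercivity.coarseGram_coercive`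
# at `V₀`, `hCTbV`∕`hGnV` = ✓p754074's `norm_lift_topMean_le`∕`norm_massive_inverse_le` at `V₀` — one `exact` each for the assembler, as in B5).
# RESULT ★★★ `sqrt_sum_normSq_far_gramInv_coords_le_of_regPr`: for `u` supported in the blocks of `S` and any finite `N` with `∀ i ∉ N, ∀ z ∈ S, r ≤ tdist(z, σ i.1)`,
# **`√Σ_i‖(if i ∈ N then 0 else (M_V⁻¹ b_f)_i)‖² ≤ (C_N(μ′)·e^{9μ′}·(8C_P²C_T e^{3μ})·4(2(1+1∕(μ−μ′)))³·√((2(1+1∕(μ′∕2)))³·4(2(1+1∕(μ′∕2)))³)·e^{−μ′r∕2})·‖toL2S u‖`**,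
# `M_V = (⟪G_1(T_1(b_c i)), G_1(T_1(b_c i′))⟫)`, `(b_f)_i = ⟪G(T(b_c i)), toL2S u⟫`, `C_N(μ′) = (m_B′²∕2 − 3ε(μ′)²)⁻¹` (B2c's constant VERBATIM), `C_P² = max 2 (16c₀L^{3(K−n)}∕(a c₁))`.

Cell `ym3-torus` (HUMAN RULING D-0037, YM ladder rung R3 — NOT d = 4, NOT infinite volume, NOT a mass gap, NOT Clay).  Width seat `ym-routeR-w2` gen 13 (routeR-w3 g12 02:38:20Z
«routeR-w2: knit RN» GO).  THEOREMS ONLY (0 `def`, 0 `sorry`); ✓p753767's member letters VERBATIM (system `U₀`) + a second copy (system `V₀`); `--supports stmt-QuantumFields-19200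
--as helper`, count-neutral.  HONEST LABEL (★★OWNER RULING №33 (6)): curved γ-row supplier line (LOD localisation), pen (L5″); a two-`exact` discharge; CONDITIONAL on the windows
(`μ`, `μ′`), the gap at `μ′` and the (L4′) coercivity of the comparison system; nothing of (RN-near), `hloc`, (L6), `hGF`, EX ∕ 19200 is proved here; the decay length `1∕μ′` is the
window's — routeR-w2 g12's quantitative flag of record (`μ′ ≲ 7·10⁻¹⁴` at the pin) applies to this tail verbatim.

WHAT IS PROVED (ns `Summit.QuantumFields.YangMills.Theorems.Prop7GramInverseFarTailOfRegPr`).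
* `gramInvConst_nonneg` (the sign of B2c's constant under the gap), ★★★ `sqrt_sum_normSq_far_gramInv_coords_le_of_regPr` (the member `htail`, two backgrounds, at `RegPr`).

References: T. Bałaban, CMP **99** (1985) 389–434 [Balaban1985BackgroundPropagators] ((3.21)–(3.26) pp.394–395, Thm 3.1 (3.46) p.398, (3.49) p.399, (3.105)–(3.106) p.414);
CMP **98** (1985) 17–51 [Balaban1985Averaging] ((2) p.17).
-/

set_option autoImplicit false

noncomputable section

open scoped BigOperators Matrix.Norms.L2Operator InnerProductSpace ComplexConjugate Matrix


open Literature.MathematicalPhysics.QuantumFieldTheory.Balaban1983to89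
open T4Continuum BlockAveraging
open BlockAveraging (Idx)
open B7Prop1Explicit (U1 disp)
open B5Eq118OneStroke (iterBlockOf)
open B10Eq27TorusAxialLog (holT transl)
open B7TransferAnalyticMean (meanCLM)
open B11Eq103H1Complex (SiteL2K BondL2K projR)
open Summit.QuantumFields.YangMills.Theorems.Prop8Chart (emlIterU)
open Literature.MathematicalPhysics.QuantumFieldTheory.Balaban1983to89.T3ContinuumYM3Torus
open T3SectALandauChart (eta eta_pos bgUnits)
open T3PrintedRegularMinimiser (RegPr)
open T3PrintedRegularOrbits (sites_eq)
open T3LevelShift (siteShift)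
open Summit.QuantumFields.YangMills.Theorems.Prop7SectET3Transport (periodsT3)
open Summit.QuantumFields.YangMills.Theorems.Prop7SectET3HilbertLetters (W₂ toL2S covLapSite)
open Summit.QuantumFields.YangMills.Theorems.Prop7SiteEntryCoordinates (orthonormal_spike top_le_span_spike)
open Summit.QuantumFields.YangMills.Theorems.Prop7CoarseGramInverseDecay (norm_gram_inv_spike_le_exp_neg_tdist)
open Summit.QuantumFields.YangMills.Theorems.Prop7ComplementaryProjectorBlockDecay (norm_inner_spike_column_le)
open Summit.QuantumFields.YangMills.Theorems.Prop7GramInverseFarTailMember (sqrt_sum_normSq_far_gramInv_coords_le)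

namespace Summit.QuantumFields.YangMills.Theorems.Prop7GramInverseFarTailOfRegPr

variable (F : T3Family) {n K : ℕ} (h : n ≤ K) {c₀ c₁ : ℝ} [Fact (0 < c₀)] [Fact (0 < c₁)]
  {ε₀ : ℝ} (hε₀ : 0 < ε₀) (hε7 : 10 ^ 7 * (F.L : ℝ) ^ 3 * ε₀ ≤ 1)
  (U₀ : GaugeField (F.P K) 0 (Matrix.specialUnitaryGroup (Fin 2) ℂ)) (hreg : RegPr F n K ε₀ U₀)
  (Q'' : SiteL2K ℂ 3 (periodsT3 F K) c₀ W₂ →ₗ[ℂ] (Site (F.P K) (K - n) → Matrix (Fin 2) (Fin 2) ℂ))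
  (hseq : ∀ lam : Site (F.P K) 0 → Matrix (Fin 2) (Fin 2) ℂ, ∃ ns : (j : ℕ) → Site (F.P K) j → Matrix (Fin 2) (Fin 2) ℂ, ns 0 = lam ∧
      (∀ (j : ℕ) (y : Site (F.P K) (j + 1)), ns (j + 1) y = ns j (emb y) - meanCLM (Idx (F.P K)) (Matrix (Fin 2) (Fin 2) ℂ) fun i : Idx (F.P K) =>
        ns j (emb y) - ((holT (emlIterU j (bgUnits F K U₀)) (emb y) (stairWord i.2.1 (off i.1)) : (Matrix (Fin 2) (Fin 2) ℂ)ˣ) : Matrix (Fin 2) (Fin 2) ℂ) *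
          ns j (transl (emb y) (disp (stairWord i.2.1 (off i.1)))) * (((holT (emlIterU j (bgUnits F K U₀)) (emb y) (stairWord i.2.1 (off i.1)))⁻¹ : (Matrix (Fin 2) (Fin 2) ℂ)ˣ) : Matrix (Fin 2) (Fin 2) ℂ)) ∧
      ns (K - n) = Q'' (toL2S F K c₀ lam))
  (ι : (Site (F.P K) (K - n) → Matrix (Fin 2) (Fin 2) ℂ) →ₗ[ℂ] SiteL2K ℂ 3 (periodsT3 F n) c₁ W₂)
  (hι : ∀ c, ι c = toL2S F n c₁ (fun z => c (siteShift (sites_eq F n K h) z)))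
  (T : SiteL2K ℂ 3 (periodsT3 F n) c₁ W₂ →ₗ[ℂ] SiteL2K ℂ 3 (periodsT3 F K) c₀ W₂)
  (hT : ∀ (l : SiteL2K ℂ 3 (periodsT3 F K) c₀ W₂) (f : SiteL2K ℂ 3 (periodsT3 F n) c₁ W₂), ⟪ι (Q'' l), f⟫_ℂ = ⟪l, T f⟫_ℂ)
  {a : ℝ} (ha : 0 < a)
  (G : SiteL2K ℂ 3 (periodsT3 F K) c₀ W₂ →ₗ[ℂ] SiteL2K ℂ 3 (periodsT3 F K) c₀ W₂)
  (hAG : ∀ f, covLapSite F n K c₀ U₀ (G f) + (a : ℂ) • T (ι (Q'' (G f))) = f)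
  (V₀ : GaugeField (F.P K) 0 (Matrix.specialUnitaryGroup (Fin 2) ℂ)) (hregV : RegPr F n K ε₀ V₀)
  (Q1 : SiteL2K ℂ 3 (periodsT3 F K) c₀ W₂ →ₗ[ℂ] (Site (F.P K) (K - n) → Matrix (Fin 2) (Fin 2) ℂ))
  (hseq1 : ∀ lam : Site (F.P K) 0 → Matrix (Fin 2) (Fin 2) ℂ, ∃ ns : (j : ℕ) → Site (F.P K) j → Matrix (Fin 2) (Fin 2) ℂ, ns 0 = lam ∧
      (∀ (j : ℕ) (y : Site (F.P K) (j + 1)), ns (j + 1) y = ns j (emb y) - meanCLM (Idx (F.P K)) (Matrix (Fin 2) (Fin 2) ℂ) fun i : Idx (F.P K) =>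
        ns j (emb y) - ((holT (emlIterU j (bgUnits F K V₀)) (emb y) (stairWord i.2.1 (off i.1)) : (Matrix (Fin 2) (Fin 2) ℂ)ˣ) : Matrix (Fin 2) (Fin 2) ℂ) *
          ns j (transl (emb y) (disp (stairWord i.2.1 (off i.1)))) * (((holT (emlIterU j (bgUnits F K V₀)) (emb y) (stairWord i.2.1 (off i.1)))⁻¹ : (Matrix (Fin 2) (Fin 2) ℂ)ˣ) : Matrix (Fin 2) (Fin 2) ℂ)) ∧
      ns (K - n) = Q1 (toL2S F K c₀ lam))
  (T1 : SiteL2K ℂ 3 (periodsT3 F n) c₁ W₂ →ₗ[ℂ] SiteL2K ℂ 3 (periodsT3 F K) c₀ W₂)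
  (hT1 : ∀ (l : SiteL2K ℂ 3 (periodsT3 F K) c₀ W₂) (f : SiteL2K ℂ 3 (periodsT3 F n) c₁ W₂), ⟪ι (Q1 l), f⟫_ℂ = ⟪l, T1 f⟫_ℂ)
  (G1 : SiteL2K ℂ 3 (periodsT3 F K) c₀ W₂ →ₗ[ℂ] SiteL2K ℂ 3 (periodsT3 F K) c₀ W₂)
  (hAG1 : ∀ f, covLapSite F n K c₀ V₀ (G1 f) + (a : ℂ) • T1 (ι (Q1 (G1 f))) = f)

/-- The B2c constant `(m_B² ∕ 2 − 3ε²)⁻¹ · e^{9μ′}` is `≥ 0` under the gap row `3ε² < m_B²∕2`. [folklore] -/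
theorem gramInvConst_nonneg {x y μ' : ℝ} (hgap : y < x) : 0 ≤ (x - y)⁻¹ * Real.exp (9 * μ') :=
  mul_nonneg (inv_nonneg.mpr (sub_pos.mpr hgap).le) (Real.exp_nonneg _)

include hε₀ hε7 hreg hseq hι hT ha hAG hregV hseq1 hT1 hAG1 in
/-- ★★★ **THE MEMBER FAR TAIL AT `RegPr`, TWO BACKGROUNDS** — ✓p757450 `sqrt_sum_normSq_far_gramInv_coords_le` at px17's spike basis with `hN` ⟸ B2c ✓`norm_gram_inv_spike_le_exp_neg_tdist`
(system `(G_1, T_1, Q_1)` at `V₀`, slope `μ′`; rows `hδV hwinV hCTbV hGnV hmBV hcoerV hgapV` displayed VERBATIM) and `hcol` ⟸ B4 §2 ✓`norm_inner_spike_column_le` (system `(G, T, Q″)` at `U₀`,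
slope `μ`; rows `hδ hwin hCTb` displayed): for `0 < μ′ < μ`, `u` supported in the blocks of `S`, `N ⊇` the spike indices within `tdist < r` of `S`:
`√Σ_i‖(if i ∈ N then 0 else (M_V⁻¹ b_f)_i)‖² ≤ (C_N(μ′)e^{9μ′}·(8C_P²C_Te^{3μ})·4(2(1+1∕(μ−μ′)))³·√((2(1+1∕(μ′∕2)))³·4(2(1+1∕(μ′∕2)))³)·e^{−μ′r∕2})·‖toL2S u‖`.
[cite: Balaban1985BackgroundPropagators, (3.21)–(3.26) pp.394–395, Thm 3.1 (3.46) p.398, (3.49) p.399, (3.105)–(3.106) p.414] -/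
theorem sqrt_sum_normSq_far_gramInv_coords_le_of_regPr {μ μ' r : ℝ} (hμ' : 0 < μ') (hμμ' : μ' < μ)
    {δ₁ : ℝ} (hδ₁ : 0 ≤ δ₁)
    (hδ : 3 * ((eta F n K)⁻¹) ^ 2 * (Real.exp (μ * eta F n K) - 1) ^ 2 + a * ((25 / 8) * (c₁ * ((((F.P K).L : ℝ) ^ (F.P K).d) ^ (K - n))⁻¹ / c₀)) * (Real.exp (3 * μ) - 1) ^ 2 ≤ δ₁ ^ 2)
    (hwin : Real.sqrt (max 2 (16 * c₀ * ((F.L : ℝ) ^ (K - n)) ^ 3 / (a * c₁))) * δ₁ ≤ 1 / 10)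
    {CT : ℝ} (hCT : 0 ≤ CT) (hCTb : ∀ l : SiteL2K ℂ 3 (periodsT3 F K) c₀ W₂, ‖ι (Q'' l)‖ ≤ CT * ‖l‖)
    {δ₁' : ℝ} (hδ₁' : 0 ≤ δ₁')
    (hδV : 3 * ((eta F n K)⁻¹) ^ 2 * (Real.exp (μ' * eta F n K) - 1) ^ 2 + a * ((25 / 8) * (c₁ * ((((F.P K).L : ℝ) ^ (F.P K).d) ^ (K - n))⁻¹ / c₀)) * (Real.exp (3 * μ') - 1) ^ 2 ≤ δ₁' ^ 2)
    (hwinV : Real.sqrt (max 2 (16 * c₀ * ((F.L : ℝ) ^ (K - n)) ^ 3 / (a * c₁))) * δ₁' ≤ 1 / 10)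
    {CT' : ℝ} (hCT' : 0 ≤ CT') (hCTbV : ∀ l : SiteL2K ℂ 3 (periodsT3 F K) c₀ W₂, ‖ι (Q1 l)‖ ≤ CT' * ‖l‖)
    {CG' : ℝ} (hCG' : 0 ≤ CG') (hGnV : ∀ f, ‖G1 f‖ ≤ CG' * ‖f‖)
    {mB' : ℝ} (hmB' : 0 < mB') (hcoerV : ∀ f : SiteL2K ℂ 3 (periodsT3 F n) c₁ W₂, mB' * ‖f‖ ≤ ‖G1 (T1 f)‖)
    (hgapV : 3 * ((Real.sqrt (max 2 (16 * c₀ * ((F.L : ℝ) ^ (K - n)) ^ 3 / (a * c₁))) * (2 + Real.sqrt (max 2 (16 * c₀ * ((F.L : ℝ) ^ (K - n)) ^ 3 / (a * c₁))))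
          * (Real.sqrt 3 * (eta F n K)⁻¹ * (Real.exp (μ' * eta F n K) - 1) + (Real.sqrt 3 * (eta F n K)⁻¹ * (Real.exp (μ' * eta F n K) - 1)) ^ 2 + Real.sqrt a * CT' * (Real.exp (3 * μ') - 1) + a * CT' ^ 2 * (Real.exp (3 * μ') - 1) ^ 2)
          * (8 * Real.sqrt (max 2 (16 * c₀ * ((F.L : ℝ) ^ (K - n)) ^ 3 / (a * c₁))) + 8 * Real.sqrt (max 2 (16 * c₀ * ((F.L : ℝ) ^ (K - n)) ^ 3 / (a * c₁))) ^ 2)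
          * (CT' * (1 + (Real.exp (3 * μ') - 1))) + CG' * (CT' * (Real.exp (3 * μ') - 1)))) ^ 2 < mB' ^ 2 / 2)
    (S : Finset (Site (F.P K) (K - n))) (u : Site (F.P K) 0 → Matrix (Fin 2) (Fin 2) ℂ) (hu : ∀ x, iterBlockOf (K - n) x ∉ S → u x = 0)
    (N : Finset (Site (F.P n) 0 × (Fin 2 × Fin 2)))
    (hfar : ∀ i, i ∉ N → ∀ z ∈ S, r ≤ (Site.tdist (P := F.P K) z (siteShift (sites_eq F n K h) i.1) : ℝ)) :
    Real.sqrt (∑ i, ‖(if i ∈ N then (0 : ℂ) else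
        ((Matrix.of fun i i' : Site (F.P n) 0 × (Fin 2 × Fin 2) => ⟪G1 (T1 ((OrthonormalBasis.mk (orthonormal_spike F) (top_le_span_spike F) : OrthonormalBasis (Site (F.P n) 0 × (Fin 2 × Fin 2)) ℂ (SiteL2K ℂ 3 (periodsT3 F n) c₁ W₂)) i)), G1 (T1 ((OrthonormalBasis.mk (orthonormal_spike F) (top_le_span_spike F) : OrthonormalBasis (Site (F.P n) 0 × (Fin 2 × Fin 2)) ℂ (SiteL2K ℂ 3 (periodsT3 F n) c₁ W₂)) i'))⟫_ℂ)⁻¹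
          *ᵥ fun i' => ⟪G (T ((OrthonormalBasis.mk (orthonormal_spike F) (top_le_span_spike F) : OrthonormalBasis (Site (F.P n) 0 × (Fin 2 × Fin 2)) ℂ (SiteL2K ℂ 3 (periodsT3 F n) c₁ W₂)) i')), toL2S F K c₀ u⟫_ℂ) i)‖ ^ 2)
      ≤ (((mB' ^ 2 / 2 - 3 * ((Real.sqrt (max 2 (16 * c₀ * ((F.L : ℝ) ^ (K - n)) ^ 3 / (a * c₁))) * (2 + Real.sqrt (max 2 (16 * c₀ * ((F.L : ℝ) ^ (K - n)) ^ 3 / (a * c₁))))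
          * (Real.sqrt 3 * (eta F n K)⁻¹ * (Real.exp (μ' * eta F n K) - 1) + (Real.sqrt 3 * (eta F n K)⁻¹ * (Real.exp (μ' * eta F n K) - 1)) ^ 2 + Real.sqrt a * CT' * (Real.exp (3 * μ') - 1) + a * CT' ^ 2 * (Real.exp (3 * μ') - 1) ^ 2)
          * (8 * Real.sqrt (max 2 (16 * c₀ * ((F.L : ℝ) ^ (K - n)) ^ 3 / (a * c₁))) + 8 * Real.sqrt (max 2 (16 * c₀ * ((F.L : ℝ) ^ (K - n)) ^ 3 / (a * c₁))) ^ 2)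
          * (CT' * (1 + (Real.exp (3 * μ') - 1))) + CG' * (CT' * (Real.exp (3 * μ') - 1)))) ^ 2)⁻¹ * Real.exp (9 * μ'))
            * (8 * (max 2 (16 * c₀ * ((F.L : ℝ) ^ (K - n)) ^ 3 / (a * c₁))) * CT * Real.exp (3 * μ))
            * (4 * (2 * (1 + 1 / (μ - μ'))) ^ 3) * Real.sqrt ((2 * (1 + 1 / (μ' / 2))) ^ 3 * (4 * (2 * (1 + 1 / (μ' / 2))) ^ 3))
          * Real.exp (-(μ' * r / 2))) * ‖toL2S F K c₀ u‖ :=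
  sqrt_sum_normSq_far_gramInv_coords_le F h (fun i => (OrthonormalBasis.mk (orthonormal_spike F) (top_le_span_spike F) : OrthonormalBasis (Site (F.P n) 0 × (Fin 2 × Fin 2)) ℂ (SiteL2K ℂ 3 (periodsT3 F n) c₁ W₂)) i) G T _
    (gramInvConst_nonneg hgapV) (by positivity) hμ' hμμ'
    (fun i i' => norm_gram_inv_spike_le_exp_neg_tdist F h hε₀ hε7 V₀ hregV Q1 hseq1 ι hι T1 hT1 ha G1 hAG1 hμ'.le hδ₁' hδV hwinV hCT' hCTbV hCG' hGnV hmB' hcoerV hgapV i i')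
    (fun i z w hw => norm_inner_spike_column_le F h hε₀ hε7 U₀ hreg Q'' hseq ι hι T hT ha G hAG (hμ'.le.trans hμμ'.le) hδ₁ hδ hwin hCT hCTb i z w hw)
    S u hu N hfar

end Summit.QuantumFields.YangMills.Theorems.Prop7GramInverseFarTailOfRegPr

end
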